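import Summits.QuantumFields.YangMills.Theorems.BalabanUVNodesN18RunningBetaLettersModelNodes
import Literature.MathematicalPhysics.QuantumFieldTheory.Balaban1983to89.T4CouplingMatching

/-!
# BalabanUVNodes ∕ N18 — THE F-E SHADOW ON NODE N18, FILE 2: THE MARGINAL-TRANSPORT TWO-BOND MODEL — a FIRST-ENTRY-ONLY term family (dag-n18-w2's `crossTermFamily`
# with the amplitude law `β₀ + α·s²∕(1 + c·k·s²)`, `s` = the bare coupling) at which N18's BOX-KEYED letter `KernelStepRate … γ κ θ₅ C₅` FAILS for EVERY `(C₅, θ₅ ∈ [0,1[)`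
# while the RUN-MATCHED η-rate comparison (FILE 1 §3, one-loop run map `nx b = b∕√(1 + c b²)`) holds EXACTLY, constant 0; N17's `ScaleShiftRate` fails the same way; N22's `NE9`
# survives with a BOUNDED first-entry modulus
# (Track A, DAG node N18 = NE5; key K3⁸ `SpineGivenEndpointR13SepCoPHV` = stmt-QuantumFields-27366, skeleton v6 b4e55110ab73e679; width seat `pub-ymgap-dag-n18-w1` g6, FILE 2 of 2)

HONEST FRAMING.  A MODEL — count-neutral, `--kind proof --supports stmt-QuantumFields-27366 --as helper`.  The term family is dag-n18-w2's mixed two-bond family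
`crossTermFamily F a e` (p613743 lineage, `…N18RunningBetaLettersModel(Nodes)`: closed-form kernels `crossKernel`, (1.21)-existence, (5.10) class, (1.22) β — ALL CITED BY NAME,
nothing re-declared) read at ONE new amplitude law, displayed as the HYPOTHESIS `ha : ∀ k v, a k v = β₀ + α·(v 0)²∕(1 + c·k·(v 0)²)` on an arbitrary `a : HBeta` and
instantiated by the explicit λ-term in §6 (THEOREMS ONLY: 0 `def`).  This law is the ym-nodeO critics' MARGINAL TRANSPORT (CRIT-2 g3 BN-N `marginalTransport_not_geomFading`,
CRIT-1 g6 §1 `F_k(g₀) ≈ β^{pr}(g_k^{run}(g₀))`, `1∕g_k² = 1∕g₀² + ck`) written in def-B ∕ def-W1 currency — it is NOT Bałaban's merged term; whether the merged term of record behaves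
like it (H_FE′ + the transport identification) is the F-E desk's question, NOT asserted.  Elementary real algebra + one standard limit (`k^p θ^k → 0`).  Nothing of Bałaban's is
asserted, inhabited, discharged or refuted; NE5 NOT PRINTED for d = 4 ∕ NOT proved; N17 ∕ N18 ∕ N22 NOT discharged; K3⁸ OPEN (v6), no stub proved ∕ refuted; K3⁷ 20544 aside.
Counts UNMOVED (typed 28∕28 · discharged 5∕27, A 5∕28).  One finite four-torus programme at fixed `ε`, Bałaban AS PRINTED; route R4 closes ONLY the conditional finite-𝕋⁴ rung
`BalabanLadder.UV` — NOT the continuum limit, NOT ℝ⁴, NOT OS, NOT the Yang–Mills mass gap, NOT Clay.  0 `def`, 0 `instance`, 0 `sorry`, standard axioms.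

WHY.  FILE 1 showed: first-entry-only ∧ N18's box letter ⟹ rigidity, hence (contrapositive) any polynomially-running first-entry-only family REFUTES the box letter, while the
RUN-KEYED letter is untouched.  This file makes both halves CONCRETE on an honest `TermFamily1`: (§3) at the constant history `(γ, γ, …)` the level step of the model's kernel
is `αcγ⁴∕((1+ckγ²)(1+c(k+1)γ²)) ≍ k⁻²` — polynomial, so `≤ C₅θ₅^{k+1}e^{−κ|e|₁}` fails at large `k` for every `C₅` and every `θ₅ ∈ [0,1[`; (§4) along the one-loop run map
`nx b = b∕√(1+cb²)` (so `1∕nx² = 1∕b² + c` — a one-loop-type step; the infrared-free SIGN keeps every run in the box and is immaterial for the mechanism) the identity `α·nx²∕(1 + ck·nx²) = α·b²∕(1 + c(k+1)b²)` makes the level-`(k+2)` kernel of `(b, g)` EQUAL to the level-`(k+1)` kernel of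
`g` whenever `g 0 = nx b`: run B with one extra ultraviolet step at MATCHED running couplings sees the same kernel — NE5's mechanism at its sharpest (constant 0), invisible to the box
keying.

WHAT (theorems only; `ρ := ContinuousLinearMap.id ℝ ℝ`, `bV := Module.Basis.singleton Unit ℝ` throughout).  §1 real-analysis core `quad_le_mul_sq` · `tendsto_sq_mul_pow` ·
`false_of_const_le_geometric_quad`.  §2 the model's kernels: `kernelA_marginalTransport` · `kernelA_firstEntryOnly_marginalTransport` · `marginal_step_sub` · `kernelA_zero_one_step_marginalTransport`.
§3 ★★ `not_kernelStepRate_marginalTransport` (∀ C₅, ∀ θ₅ ∈ [0,1[) · `not_scaleShiftRate_betaMerged_marginalTransport` (N17's letter, ∀ ρ ∈ [0,1[; remark).  §4 ★★ `nx_pos` · `nx_le` · `nx_sq` ·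
`marginal_run_identity` · `kernelA_prepend_eq_of_runMatched_marginalTransport` · `runStepRate_marginalTransport_zero`.  §5 the survivors at the model ((1.21)-existence is dag-n18-w2's `polLimitsExist_cross`, cited): `kernelDecay_marginalTransport` ·
`marginal_firstEntry_lipschitz` · `ne9_EA_marginalTransport` (N22's NE9 with the BOUNDED first-entry modulus `2|α|γ·wt`, zero memory of older entries).
§6 ★ `exists_termFamily_firstEntryOnly_boxFails_runExact` (the explicit λ-term instance: one `TermFamily1 F ℝ` carrying all of §2–§5).

References (TYPES ∕ locators only): [Balaban1987RG1] CMP **109** (1987): (0.18)–(0.20) pp. 255–256, (0.28)–(0.30) p. 258, p. 259 Thm 1 and L4–9, (1.20)–(1.22) p. 264,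
(5.10) p. 293, §5 p. 298.
-/

noncomputable section

open Filter Topology
open scoped BigOperators

namespace YMDAG.N18.KernelLettersFirstEntryOnly.Model

open Literature.MathematicalPhysics.QuantumFieldTheory.Balaban1983to89
open Literature.MathematicalPhysics.QuantumFieldTheory.Balaban1983to89.T4Continuum (T4Family)
open Literature.MathematicalPhysics.QuantumFieldTheory.Balaban1983to89.T4OutputRate (Window NE9)
open Literature.MathematicalPhysics.QuantumFieldTheory.Balaban1983to89.FlowStep (Box HBeta mem_box)
open Literature.MathematicalPhysics.QuantumFieldTheory.Balaban1983to89.T4CouplingMatching (ScaleShiftRate)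
open Literature.MathematicalPhysics.QuantumFieldTheory.Balaban1983to89.Node00 (TermFamily1 betaMerged prependCoupling prependCoupling_zero prependCoupling_succ)
open Literature.MathematicalPhysics.QuantumFieldTheory.Balaban1983to89.Node00.U3OfKernels (kernelA EA histPrefix histPrefix_apply KernelDecay)
open Literature.MathematicalPhysics.QuantumFieldTheory.Balaban1983to89.Node00.U3KernelLetters (KernelStepRate PolLimitsExist)
open Literature.MathematicalPhysics.QuantumFieldTheory.Balaban1983to89.B12Sec2to5 (l1)
open YMDAG.N18.RunningBetaLettersModel (crossKernel crossKernel_sub crossKernel_zero_one wt crossTermFamily kernelA_crossTermFamily betaMerged_crossTermFamily diag01 diag01_mul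
  polLimitsExist_cross kernelDecay_cross ne9_EA_cross)

/-! ## §1 The real-analysis core: a positive constant is NOT below `B·θ^k·(1 + ckγ²)(1 + c(k+1)γ²)` for all `k` when `0 ≤ θ < 1` (polynomial growth loses to geometric decay) -/

/-- `(1 + ckγ²)(1 + c(k+1)γ²) ≤ (1 + cγ²)²·(k+1)²` for `c ≥ 0`. [folklore] -/
theorem quad_le_mul_sq {c : ℝ} (hc : 0 ≤ c) (γ : ℝ) (k : ℕ) :
    (1 + c * k * γ ^ 2) * (1 + c * (k + 1) * γ ^ 2) ≤ (1 + c * γ ^ 2) ^ 2 * ((k : ℝ) + 1) ^ 2 := by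
  have hk : (0 : ℝ) ≤ k := Nat.cast_nonneg k
  have hcg : 0 ≤ c * γ ^ 2 := mul_nonneg hc (sq_nonneg γ)
  have h1 : 1 + c * k * γ ^ 2 ≤ (1 + c * γ ^ 2) * ((k : ℝ) + 1) := by nlinarith
  have h2 : 1 + c * (k + 1) * γ ^ 2 ≤ (1 + c * γ ^ 2) * ((k : ℝ) + 1) := by nlinarith
  have h0 : 0 ≤ 1 + c * k * γ ^ 2 := by positivity
  have h0' : 0 ≤ 1 + c * (k + 1) * γ ^ 2 := by positivity
  calc (1 + c * k * γ ^ 2) * (1 + c * (k + 1) * γ ^ 2) ≤ ((1 + c * γ ^ 2) * ((k : ℝ) + 1)) * ((1 + c * γ ^ 2) * ((k : ℝ) + 1)) :=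
        mul_le_mul h1 h2 h0' (h0.trans h1)
    _ = (1 + c * γ ^ 2) ^ 2 * ((k : ℝ) + 1) ^ 2 := by ring

/-- `(k+1)²·θ^k → 0` for `|θ| < 1` (Mathlib's `n^p θ^n → 0`, `p = 0, 1, 2`). [folklore] -/
theorem tendsto_sq_mul_pow {θ : ℝ} (hθ : |θ| < 1) : Tendsto (fun k : ℕ => ((k : ℝ) + 1) ^ 2 * θ ^ k) atTop (𝓝 0) := by
  have h2 := tendsto_pow_const_mul_const_pow_of_abs_lt_one 2 hθ
  have h1 := tendsto_pow_const_mul_const_pow_of_abs_lt_one 1 hθ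
  have h0 := tendsto_pow_const_mul_const_pow_of_abs_lt_one 0 hθ
  have h := (h2.add (h1.const_mul 2)).add h0
  simp only [add_zero, mul_zero] at h
  refine h.congr fun k => ?_
  ring

/-- ★ **THE CORE**: `0 < A`, `0 ≤ c`, `0 ≤ θ < 1` and `A ≤ B·θ^k·(1 + ckγ²)(1 + c(k+1)γ²)` for ALL `k` is absurd (the right side is `≤ |B|(1+cγ²)²·(k+1)²θ^k → 0`).
[cite: Balaban1987RG1, (0.28)–(0.30) p.258 and p.259 L4–9 (context: irrelevant vs marginal; the lemma is folklore)] -/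
theorem false_of_const_le_geometric_quad {A B c γ θ : ℝ} (hA : 0 < A) (hc : 0 ≤ c) (hθ0 : 0 ≤ θ) (hθ1 : θ < 1)
    (h : ∀ k : ℕ, A ≤ B * θ ^ k * ((1 + c * k * γ ^ 2) * (1 + c * (k + 1) * γ ^ 2))) : False := by
  have hθa : |θ| < 1 := by rwa [abs_of_nonneg hθ0]
  have ht : Tendsto (fun k : ℕ => |B| * (1 + c * γ ^ 2) ^ 2 * (((k : ℝ) + 1) ^ 2 * θ ^ k)) atTop (𝓝 0) := by
    simpa using (tendsto_sq_mul_pow hθa).const_mul (|B| * (1 + c * γ ^ 2) ^ 2)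
  have hev := (ht.eventually (gt_mem_nhds hA)).exists
  obtain ⟨k, hk⟩ := hev
  have hθk : 0 ≤ θ ^ k := pow_nonneg hθ0 k
  have hq := quad_le_mul_sq hc γ k
  have hq0 : 0 ≤ (1 + c * k * γ ^ 2) * (1 + c * (k + 1) * γ ^ 2) := by
    have : (0 : ℝ) ≤ k := Nat.cast_nonneg k
    have hcg : 0 ≤ c * γ ^ 2 := mul_nonneg hc (sq_nonneg γ)
    have a1 : 0 ≤ 1 + c * k * γ ^ 2 := by nlinarith
    have a2 : 0 ≤ 1 + c * (k + 1) * γ ^ 2 := by nlinarith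
    exact mul_nonneg a1 a2
  have hbound : B * θ ^ k * ((1 + c * k * γ ^ 2) * (1 + c * (k + 1) * γ ^ 2)) ≤ |B| * (1 + c * γ ^ 2) ^ 2 * (((k : ℝ) + 1) ^ 2 * θ ^ k) := by
    calc B * θ ^ k * ((1 + c * k * γ ^ 2) * (1 + c * (k + 1) * γ ^ 2))
        ≤ |B| * θ ^ k * ((1 + c * k * γ ^ 2) * (1 + c * (k + 1) * γ ^ 2)) :=
          mul_le_mul_of_nonneg_right (mul_le_mul_of_nonneg_right (le_abs_self B) hθk) hq0
      _ ≤ |B| * θ ^ k * ((1 + c * γ ^ 2) ^ 2 * ((k : ℝ) + 1) ^ 2) := mul_le_mul_of_nonneg_left hq (mul_nonneg (abs_nonneg B) hθk)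
      _ = |B| * (1 + c * γ ^ 2) ^ 2 * (((k : ℝ) + 1) ^ 2 * θ ^ k) := by ring
  exact (lt_irrefl A) (((h k).trans hbound).trans_lt hk)

/-! ## §2 The marginal-transport amplitude law on dag-n18-w2's two-bond family: closed-form, FIRST-ENTRY-ONLY kernels -/

section Model

variable (F : T4Family) {a : HBeta} {β₀ α c : ℝ}

/-- **THE MODEL's LIMITING KERNELS**: with the amplitude law `a k v = β₀ + α (v 0)²∕(1 + c k (v 0)²)` (displayed hypothesis `ha`), def-W1's level-`(k+1)` kernel at a coupling
sequence `g` is `crossKernel (β₀ + α (g 0)²∕(1 + c k (g 0)²)) e` — it reads `g` ONLY through the bare coupling `g 0`, transported `k` steps by the one-loop-type factor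
`(1 + ck s²)⁻¹` (dag-n18-w2 `kernelA_crossTermFamily`). [cite: Balaban1987RG1, (1.21) p.264 and (0.18) p.255; model] -/
theorem kernelA_marginalTransport (ha : ∀ (k : ℕ) (v : Fin (k + 1) → ℝ), a k v = β₀ + α * (v 0) ^ 2 / (1 + c * k * (v 0) ^ 2)) (e : Fin 4 → ℤ)
    (g : ℕ → ℝ) (k : ℕ) (μ ν : Fin 4) (z : Fin 4 → ℤ) :
    kernelA F (crossTermFamily F a e) (ContinuousLinearMap.id ℝ ℝ) (Module.Basis.singleton Unit ℝ) g k μ ν z =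
      crossKernel (β₀ + α * (g 0) ^ 2 / (1 + c * k * (g 0) ^ 2)) e μ ν z := by
  rw [kernelA_crossTermFamily, ha]
  simp [histPrefix_apply]

/-- **THE MODEL IS FIRST-ENTRY-ONLY** (FILE 1's displayed hypothesis, met on ALL of `ℕ → ℝ`, a fortiori on every window). [cite: Balaban1987RG1, (0.17)–(0.19) p.255; model] -/
theorem kernelA_firstEntryOnly_marginalTransport (ha : ∀ (k : ℕ) (v : Fin (k + 1) → ℝ), a k v = β₀ + α * (v 0) ^ 2 / (1 + c * k * (v 0) ^ 2)) (e : Fin 4 → ℤ)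
    (γ : ℝ) : ∀ g ∈ Window γ, ∀ g' ∈ Window γ, g 0 = g' 0 → ∀ (k : ℕ) (μ ν : Fin 4) (z : Fin 4 → ℤ),
      kernelA F (crossTermFamily F a e) (ContinuousLinearMap.id ℝ ℝ) (Module.Basis.singleton Unit ℝ) g k μ ν z =
        kernelA F (crossTermFamily F a e) (ContinuousLinearMap.id ℝ ℝ) (Module.Basis.singleton Unit ℝ) g' k μ ν z := by
  intro g _ g' _ h0 k μ ν z
  rw [kernelA_marginalTransport F ha, kernelA_marginalTransport F ha, h0]

/-- **THE LEVEL STEP OF THE TRANSPORT FACTOR** (pure algebra): `α s²∕(1 + cks²) − α s²∕(1 + c(k+1)s²) = α c s⁴ ∕ ((1 + cks²)(1 + c(k+1)s²))` (`c ≥ 0`). [folklore] -/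
theorem marginal_step_sub (hc : 0 ≤ c) (s : ℝ) (k : ℕ) :
    α * s ^ 2 / (1 + c * k * s ^ 2) - α * s ^ 2 / (1 + c * (k + 1) * s ^ 2) = α * c * s ^ 4 / ((1 + c * k * s ^ 2) * (1 + c * (k + 1) * s ^ 2)) := by
  have hk : (0 : ℝ) ≤ k := Nat.cast_nonneg k
  have hcs : 0 ≤ c * s ^ 2 := mul_nonneg hc (sq_nonneg s)
  have h1 : (1 + c * k * s ^ 2) ≠ 0 := by nlinarith
  have h2 : (1 + c * (k + 1) * s ^ 2) ≠ 0 := by nlinarith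
  field_simp
  ring

/-- **THE BOX LETTER's TEST PAIR AT THE CONSTANT HISTORY**: at `g = (s, s, …)` and the prepended `(s, s, s, …)` the mixed entry `(0,1)` at `z = e` of the step difference IS the
transport step `α c s⁴∕((1 + cks²)(1 + c(k+1)s²))` — this is what `KernelStepRate` must bound by `C₅θ₅^{k+1}e^{−κ|e|₁}`. [cite: Balaban1987RG1, Thm 1 p.259 and (1.21) p.264; model] -/
theorem kernelA_zero_one_step_marginalTransport (ha : ∀ (k : ℕ) (v : Fin (k + 1) → ℝ), a k v = β₀ + α * (v 0) ^ 2 / (1 + c * k * (v 0) ^ 2)) (hc : 0 ≤ c)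
    (e : Fin 4 → ℤ) (s : ℝ) (k : ℕ) :
    kernelA F (crossTermFamily F a e) (ContinuousLinearMap.id ℝ ℝ) (Module.Basis.singleton Unit ℝ) (fun _ => s) k 0 1 e -
        kernelA F (crossTermFamily F a e) (ContinuousLinearMap.id ℝ ℝ) (Module.Basis.singleton Unit ℝ) (prependCoupling s fun _ => s) (k + 1) 0 1 e =
      α * c * s ^ 4 / ((1 + c * k * s ^ 2) * (1 + c * (k + 1) * s ^ 2)) := by
  rw [kernelA_marginalTransport F ha, kernelA_marginalTransport F ha, prependCoupling_zero, crossKernel_sub, crossKernel_zero_one, if_pos rfl, ← marginal_step_sub hc s k]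
  push_cast
  ring

/-! ## §3 ★★ N18's BOX-KEYED LETTER FAILS AT THE MODEL for every constant and every rate `θ₅ ∈ [0,1[` (and so does N17's `ScaleShiftRate` for the model's β) -/

/-- ★★ **THE BOX-KEYED `KernelStepRate` FAILS AT THE MARGINAL-TRANSPORT MODEL FOR EVERY `(C₅, θ₅ ∈ [0,1[)`** (`α ≠ 0`, `0 < c`, `0 < γ`; any `κ`, any separation `e`): the letter at
`b = γ`, `g = (γ, γ, …)` would give `|α|cγ⁴ ≤ C₅e^{−κ|e|₁}·θ₅·θ₅^k·(1 + ckγ²)(1 + c(k+1)γ²)` for all `k` — §1's absurdity.  A first-entry-only family with MARGINAL (polynomial)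
running, typed through def-B ∕ def-W1's actual (1.20)–(1.22) machinery, refutes the box keying; FILE 1 §2 is the general statement. [cite: Balaban1987RG1, Thm 1 p.259 and p.259 L4–9; model] -/
theorem not_kernelStepRate_marginalTransport (ha : ∀ (k : ℕ) (v : Fin (k + 1) → ℝ), a k v = β₀ + α * (v 0) ^ 2 / (1 + c * k * (v 0) ^ 2)) (hα : α ≠ 0) (hc : 0 < c)
    {γ : ℝ} (hγ : 0 < γ) (e : Fin 4 → ℤ) (κ C₅ : ℝ) {θ₅ : ℝ} (hθ0 : 0 ≤ θ₅) (hθ1 : θ₅ < 1) :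
    ¬ KernelStepRate F (crossTermFamily F a e) (ContinuousLinearMap.id ℝ ℝ) (Module.Basis.singleton Unit ℝ) γ κ θ₅ C₅ := by
  intro h18
  have hs : (fun _ : ℕ => γ) ∈ Window γ := fun _ => ⟨hγ, le_rfl⟩
  have hA : 0 < |α| * c * γ ^ 4 := by positivity
  refine false_of_const_le_geometric_quad (B := C₅ * Real.exp (-(κ * l1 e)) * θ₅) (γ := γ) hA hc.le hθ0 hθ1 fun k => ?_
  have hk : (0 : ℝ) ≤ k := Nat.cast_nonneg k
  have hcg : 0 ≤ c * γ ^ 2 := mul_nonneg hc.le (sq_nonneg γ)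
  have hP : 0 < (1 + c * k * γ ^ 2) * (1 + c * (k + 1) * γ ^ 2) := by
    have a1 : 0 < 1 + c * k * γ ^ 2 := by nlinarith
    have a2 : 0 < 1 + c * (k + 1) * γ ^ 2 := by nlinarith
    exact mul_pos a1 a2
  have h := h18 γ hγ le_rfl _ hs k 0 1 e
  rw [kernelA_zero_one_step_marginalTransport F ha hc.le e γ k, abs_div, abs_of_pos hP, div_le_iff₀ hP] at h
  have habs : |α * c * γ ^ 4| = |α| * c * γ ^ 4 := by
    rw [abs_mul, abs_mul, abs_of_pos hc, abs_of_nonneg (by positivity : (0 : ℝ) ≤ γ ^ 4)]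
  rw [habs] at h
  calc |α| * c * γ ^ 4 ≤ C₅ * θ₅ ^ (k + 1) * Real.exp (-(κ * l1 e)) * ((1 + c * k * γ ^ 2) * (1 + c * (k + 1) * γ ^ 2)) := h
    _ = C₅ * Real.exp (-(κ * l1 e)) * θ₅ * θ₅ ^ k * ((1 + c * k * γ ^ 2) * (1 + c * (k + 1) * γ ^ 2)) := by ring

/-- **THE MODEL's (1.22) β at the diagonal separation** `e = (1,1,0,0)`: `betaMerged = (k, v) ↦ β₀ + α (v 0)²∕(1 + ck(v 0)²)` — «β^{pr} transported along the one-loop run from the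
bare coupling», CRIT-1 g6 §1's `F_k` (dag-n18-w2 `betaMerged_crossTermFamily`, `diag01_mul`). [cite: Balaban1987RG1, (1.22) p.264 and p.255; model] -/
theorem betaMerged_marginalTransport_diag01 (ha : ∀ (k : ℕ) (v : Fin (k + 1) → ℝ), a k v = β₀ + α * (v 0) ^ 2 / (1 + c * k * (v 0) ^ 2)) (k : ℕ)
    (v : Fin (k + 1) → ℝ) :
    betaMerged F (crossTermFamily F a diag01) (ContinuousLinearMap.id ℝ ℝ) (Module.Basis.singleton Unit ℝ) k v = β₀ + α * (v 0) ^ 2 / (1 + c * k * (v 0) ^ 2) := by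
  rw [betaMerged_crossTermFamily]
  show a k v * ((diag01 0 : ℤ) * diag01 1 : ℝ) = _
  rw [diag01_mul, mul_one, ha]

/-- **REMARK (N17's letter at the model, = the critics' BN-N in def-B currency)**: node U2's `ScaleShiftRate c' ρ γ` FAILS for the model's merged β for EVERY `c'` and EVERY
`ρ ∈ [0,1[` — at the constant box history `(γ, …, γ)` the scale shift is the same transport step `αcγ⁴∕((1+ckγ²)(1+c(k+1)γ²)) ≍ k⁻²`.  Dropped on an N17 STOP; typed because it is
the same three lines. [cite: Balaban1987RG1, §5 p.298 and p.255; model] -/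
theorem not_scaleShiftRate_betaMerged_marginalTransport (ha : ∀ (k : ℕ) (v : Fin (k + 1) → ℝ), a k v = β₀ + α * (v 0) ^ 2 / (1 + c * k * (v 0) ^ 2)) (hα : α ≠ 0)
    (hc : 0 < c) {γ : ℝ} (hγ : 0 < γ) (c' : ℝ) {ρ : ℝ} (hρ0 : 0 ≤ ρ) (hρ1 : ρ < 1) :
    ¬ ScaleShiftRate c' ρ γ (betaMerged F (crossTermFamily F a diag01) (ContinuousLinearMap.id ℝ ℝ) (Module.Basis.singleton Unit ℝ)) := by
  intro hss
  have hA : 0 < |α| * c * γ ^ 4 := by positivity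
  refine false_of_const_le_geometric_quad (B := c') (γ := γ) hA hc.le hρ0 hρ1 fun k => ?_
  have hk : (0 : ℝ) ≤ k := Nat.cast_nonneg k
  have hcg : 0 ≤ c * γ ^ 2 := mul_nonneg hc.le (sq_nonneg γ)
  have hP : 0 < (1 + c * k * γ ^ 2) * (1 + c * (k + 1) * γ ^ 2) := by
    have a1 : 0 < 1 + c * k * γ ^ 2 := by nlinarith
    have a2 : 0 < 1 + c * (k + 1) * γ ^ 2 := by nlinarith
    exact mul_pos a1 a2
  have hw : (fun _ : Fin (k + 2) => γ) ∈ Box γ (k + 1) := mem_box.mpr fun _ => ⟨hγ, le_rfl⟩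
  have h := hss k (fun _ => γ) hw
  have htail : Fin.tail (fun _ : Fin (k + 2) => γ) = fun _ : Fin (k + 1) => γ := rfl
  rw [htail, betaMerged_marginalTransport_diag01 F ha, betaMerged_marginalTransport_diag01 F ha] at h
  have hstep : β₀ + α * γ ^ 2 / (1 + c * ↑(k + 1) * γ ^ 2) - (β₀ + α * γ ^ 2 / (1 + c * k * γ ^ 2)) =
      -(α * c * γ ^ 4 / ((1 + c * k * γ ^ 2) * (1 + c * (k + 1) * γ ^ 2))) := by
    rw [← marginal_step_sub hc.le γ k]
    push_cast
    ring
  rw [hstep, abs_neg, abs_div, abs_of_pos hP, div_le_iff₀ hP] at h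
  have habs : |α * c * γ ^ 4| = |α| * c * γ ^ 4 := by
    rw [abs_mul, abs_mul, abs_of_pos hc, abs_of_nonneg (by positivity : (0 : ℝ) ≤ γ ^ 4)]
  rw [habs] at h
  calc |α| * c * γ ^ 4 ≤ c' * ρ ^ k * ((1 + c * k * γ ^ 2) * (1 + c * (k + 1) * γ ^ 2)) := h
    _ = c' * ρ ^ k * ((1 + c * k * γ ^ 2) * (1 + c * (k + 1) * γ ^ 2)) := rfl

/-! ## §4 ★★ THE RUN-MATCHED η-RATE COMPARISON HOLDS EXACTLY (constant 0) along the one-loop run map `nx b = b ∕ √(1 + c b²)` -/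

/-- `0 < b ∕ √(1 + c b²)` for `b > 0`, `c ≥ 0`. [folklore] -/
theorem nx_pos (hc : 0 ≤ c) {b : ℝ} (hb : 0 < b) : 0 < b / Real.sqrt (1 + c * b ^ 2) := by
  have : 0 < 1 + c * b ^ 2 := by nlinarith [mul_nonneg hc (sq_nonneg b)]
  exact div_pos hb (Real.sqrt_pos.mpr this)

/-- `b ∕ √(1 + c b²) ≤ b` for `b ≥ 0`, `c ≥ 0` — the model's run map DECREASES the coupling along the run (infrared-free sign, chosen so that every run stays inside the box `]0,γ]`
at all levels; with the asymptotically-free sign `1∕nx² = 1∕b² − c` of [I] (0.18) the run leaves the box after finitely many steps — the SIGN is immaterial for the box-vs-run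
mechanism this model exhibits). [cite: Balaban1987RG1, (0.18) p.255 (sign convention; model)] -/
theorem nx_le (hc : 0 ≤ c) {b : ℝ} (hb : 0 ≤ b) : b / Real.sqrt (1 + c * b ^ 2) ≤ b := by
  have h1 : 1 ≤ Real.sqrt (1 + c * b ^ 2) := by
    calc (1 : ℝ) = Real.sqrt 1 := Real.sqrt_one.symm
      _ ≤ Real.sqrt (1 + c * b ^ 2) := Real.sqrt_le_sqrt (by nlinarith [mul_nonneg hc (sq_nonneg b)])
  exact div_le_self hb h1

/-- `(b ∕ √(1 + c b²))² = b² ∕ (1 + c b²)` — i.e. `1∕nx² = 1∕b² + c`: ONE (0.18)-type step with a constant one-loop coefficient `c` (infrared-free sign, see `nx_le`).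
[cite: Balaban1987RG1, (0.18) p.255; model] -/
theorem nx_sq (hc : 0 ≤ c) (b : ℝ) : (b / Real.sqrt (1 + c * b ^ 2)) ^ 2 = b ^ 2 / (1 + c * b ^ 2) := by
  have h0 : 0 ≤ 1 + c * b ^ 2 := by nlinarith [mul_nonneg hc (sq_nonneg b)]
  rw [div_pow, Real.sq_sqrt h0]

/-- ★ **THE TRANSPORT IDENTITY**: `β₀ + α·nx²∕(1 + ck·nx²) = β₀ + α·b²∕(1 + c(k+1)·b²)` — transporting `k` steps from `nx b` equals transporting `k + 1` steps from `b`.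
[cite: Balaban1987RG1, (0.18)–(0.20) pp.255–256; model] -/
theorem marginal_run_identity (hc : 0 ≤ c) (β₀ α : ℝ) (b : ℝ) (k : ℕ) :
    β₀ + α * (b / Real.sqrt (1 + c * b ^ 2)) ^ 2 / (1 + c * k * (b / Real.sqrt (1 + c * b ^ 2)) ^ 2) =
      β₀ + α * b ^ 2 / (1 + c * ↑(k + 1) * b ^ 2) := by
  rw [nx_sq hc]
  have hk : (0 : ℝ) ≤ k := Nat.cast_nonneg k
  have hcb : 0 ≤ c * b ^ 2 := mul_nonneg hc (sq_nonneg b)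
  have h1 : (1 + c * b ^ 2) ≠ 0 := by nlinarith
  have h2 : (1 + c * ↑(k + 1) * b ^ 2) ≠ 0 := by push_cast; nlinarith
  have h3 : 1 + c * k * (b ^ 2 / (1 + c * b ^ 2)) ≠ 0 := by
    have : 0 ≤ b ^ 2 / (1 + c * b ^ 2) := div_nonneg (sq_nonneg b) (by nlinarith)
    nlinarith [mul_nonneg (mul_nonneg hc hk) this]
  push_cast
  field_simp
  ring

/-- ★★ **RUN-MATCHED NE5 AT THE MODEL IS EXACT**: whenever the sequence `g` starts at the RUN SUCCESSOR of `b` (`g 0 = b∕√(1 + c b²)`), the level-`(k+2)` kernel of the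
prepended sequence `(b, g)` EQUALS the level-`(k+1)` kernel of `g` — every entry, every `k`: run B (one extra ultraviolet step, bare coupling `b`) and run A (bare coupling `nx b`)
see the SAME kernel at matched running couplings.  This is the content print's η-rate mechanism compares (here with rate constant 0), and it coexists with §3's failure of the
box-keyed letter. [cite: Balaban1987RG1, Thm 1 p.259 and (0.18)–(0.20) pp.255–256; model] -/
theorem kernelA_prepend_eq_of_runMatched_marginalTransport (ha : ∀ (k : ℕ) (v : Fin (k + 1) → ℝ), a k v = β₀ + α * (v 0) ^ 2 / (1 + c * k * (v 0) ^ 2))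
    (hc : 0 ≤ c) (e : Fin 4 → ℤ) {b : ℝ} {g : ℕ → ℝ} (hg0 : g 0 = b / Real.sqrt (1 + c * b ^ 2)) (k : ℕ) (μ ν : Fin 4) (z : Fin 4 → ℤ) :
    kernelA F (crossTermFamily F a e) (ContinuousLinearMap.id ℝ ℝ) (Module.Basis.singleton Unit ℝ) (prependCoupling b g) (k + 1) μ ν z =
      kernelA F (crossTermFamily F a e) (ContinuousLinearMap.id ℝ ℝ) (Module.Basis.singleton Unit ℝ) g k μ ν z := by
  rw [kernelA_marginalTransport F ha, kernelA_marginalTransport F ha, prependCoupling_zero, hg0, marginal_run_identity hc]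

/-- **THE RUN-KEYED STEP RATE (FILE 1 §3's shape) HOLDS AT THE MODEL WITH CONSTANT `C₅ = 0`** for every rate `θ₅` and every `κ`, along the one-loop run map — where §3 showed
the BOX-keyed letter fails for every `(C₅, θ₅ < 1)`.  The located repair R-N18-RUN in one line: key NE5 on matched runs, not on the box.
[cite: Balaban1987RG1, Thm 1 p.259 and (0.18)–(0.20) pp.255–256; model] -/
theorem runStepRate_marginalTransport_zero (ha : ∀ (k : ℕ) (v : Fin (k + 1) → ℝ), a k v = β₀ + α * (v 0) ^ 2 / (1 + c * k * (v 0) ^ 2)) (hc : 0 ≤ c)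
    (e : Fin 4 → ℤ) (γ κ θ₅ : ℝ) :
    ∀ b : ℝ, 0 < b → b ≤ γ → ∀ g ∈ Window γ, g 0 = b / Real.sqrt (1 + c * b ^ 2) → ∀ (k : ℕ) (μ ν : Fin 4) (z : Fin 4 → ℤ),
      |kernelA F (crossTermFamily F a e) (ContinuousLinearMap.id ℝ ℝ) (Module.Basis.singleton Unit ℝ) g k μ ν z -
          kernelA F (crossTermFamily F a e) (ContinuousLinearMap.id ℝ ℝ) (Module.Basis.singleton Unit ℝ) (prependCoupling b g) (k + 1) μ ν z| ≤
        0 * θ₅ ^ (k + 1) * Real.exp (-(κ * l1 z)) := by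
  intro b _ _ g _ hg0 k μ ν z
  rw [kernelA_prepend_eq_of_runMatched_marginalTransport F ha hc e hg0, sub_self, abs_zero, zero_mul, zero_mul]

/-! ## §5 What SURVIVES at the model: (1.21)-existence, the (5.10) class, and N22's NE9 with a BOUNDED FIRST-ENTRY modulus (no memory of older entries at all) -/

/-- The (5.10) class on the window at every rate `κ` (dag-n18-w2 `kernelDecay_cross`; amplitude bound `|β₀| + |α|(g 0)²` along each sequence, uniform in the level since
`s²∕(1 + cks²) ≤ s²`). [cite: Balaban1987RG1, (5.10) p.293; model] -/
theorem kernelDecay_marginalTransport (ha : ∀ (k : ℕ) (v : Fin (k + 1) → ℝ), a k v = β₀ + α * (v 0) ^ 2 / (1 + c * k * (v 0) ^ 2)) (hc : 0 ≤ c)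
    (e : Fin 4 → ℤ) (γ : ℝ) (μ ν : Fin 4) (κ : ℝ) :
    KernelDecay F (crossTermFamily F a e) (ContinuousLinearMap.id ℝ ℝ) (Module.Basis.singleton Unit ℝ) (Window γ) μ ν κ := by
  refine kernelDecay_cross F (fun g _ => ⟨|β₀| + |α| * (g 0) ^ 2, fun k => ?_⟩) e μ ν κ
  rw [ha]
  simp only [histPrefix_apply, Fin.val_zero]
  have hk : (0 : ℝ) ≤ k := Nat.cast_nonneg k
  have hs2 : 0 ≤ (g 0) ^ 2 := sq_nonneg _
  have hD : 1 ≤ 1 + c * k * (g 0) ^ 2 := by nlinarith [mul_nonneg (mul_nonneg hc hk) hs2]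
  have hfrac : |α * (g 0) ^ 2 / (1 + c * k * (g 0) ^ 2)| ≤ |α| * (g 0) ^ 2 := by
    rw [abs_div, abs_mul, abs_of_nonneg hs2, abs_of_pos (show (0 : ℝ) < 1 + c * k * (g 0) ^ 2 by linarith)]
    exact div_le_self (mul_nonneg (abs_nonneg α) hs2) hD
  exact (abs_add_le _ _).trans (by linarith)

/-- **THE FIRST-ENTRY LIPSCHITZ STEP** (pure algebra): `|α s²∕(1+cks²) − α t²∕(1+ckt²)| = |α||s − t||s + t|∕((1+cks²)(1+ckt²)) ≤ 2|α|γ·|s − t|` for `s, t ∈ ]0,γ]`, `c ≥ 0` —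
the BOUNDED (indeed `k`-uniform) modulus in the bare coupling that survives H_FE′ (CRIT-1 g6 §1: `HistLipschitz` with bounded first-entry modulus ✓, `FadingMemory` ✗). [folklore] -/
theorem marginal_firstEntry_lipschitz (hc : 0 ≤ c) {γ s t : ℝ} (hs : 0 < s) (hsγ : s ≤ γ) (ht : 0 < t) (htγ : t ≤ γ) (β₀ : ℝ) (k : ℕ) :
    |β₀ + α * s ^ 2 / (1 + c * k * s ^ 2) - (β₀ + α * t ^ 2 / (1 + c * k * t ^ 2))| ≤ 2 * |α| * γ * |s - t| := by
  have hk : (0 : ℝ) ≤ k := Nat.cast_nonneg k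
  have hck : 0 ≤ c * k := mul_nonneg hc hk
  have hDs : 1 ≤ 1 + c * k * s ^ 2 := by nlinarith [mul_nonneg hck (sq_nonneg s)]
  have hDt : 1 ≤ 1 + c * k * t ^ 2 := by nlinarith [mul_nonneg hck (sq_nonneg t)]
  have hDs0 : 0 < 1 + c * k * s ^ 2 := by linarith
  have hDt0 : 0 < 1 + c * k * t ^ 2 := by linarith
  have heq : β₀ + α * s ^ 2 / (1 + c * k * s ^ 2) - (β₀ + α * t ^ 2 / (1 + c * k * t ^ 2)) =
      α * ((s - t) * (s + t)) / ((1 + c * k * s ^ 2) * (1 + c * k * t ^ 2)) := by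
    field_simp
    ring
  rw [heq, abs_div, abs_mul, abs_mul, abs_of_pos (mul_pos hDs0 hDt0)]
  have hst : |s + t| ≤ 2 * γ := by rw [abs_of_pos (by linarith)]; linarith
  have hP1 : 1 ≤ (1 + c * k * s ^ 2) * (1 + c * k * t ^ 2) := by nlinarith
  calc |α| * (|s - t| * |s + t|) / ((1 + c * k * s ^ 2) * (1 + c * k * t ^ 2)) ≤ |α| * (|s - t| * |s + t|) := div_le_self (by positivity) hP1
    _ ≤ |α| * (|s - t| * (2 * γ)) := mul_le_mul_of_nonneg_left (mul_le_mul_of_nonneg_left hst (abs_nonneg _)) (abs_nonneg _)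
    _ = 2 * |α| * γ * |s - t| := by ring

/-- ★ **N22's NE9 SURVIVES AT THE MODEL WITH A BOUNDED FIRST-ENTRY MODULUS AND ZERO MEMORY OF EVERY OLDER ENTRY**: `NE9 (EA …) (Window γ) κ Λ` with
`Λ n i = wt κ e · (2|α|γ·[i = 0])` (dag-n18-w2 `ne9_EA_cross`) — history-Lipschitz in the bare coupling only, `k`-uniform, no geometric fading (`Λ (k+1) 0` does not decay), the
survivor letter of CRIT-2's R-BM list read at the kernels. [cite: Balaban1987RG1, §1 p.263 and §5 p.298; model] -/
theorem ne9_EA_marginalTransport (ha : ∀ (k : ℕ) (v : Fin (k + 1) → ℝ), a k v = β₀ + α * (v 0) ^ 2 / (1 + c * k * (v 0) ^ 2)) (hc : 0 ≤ c) {γ : ℝ}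
    (e : Fin 4 → ℤ) (κ : ℝ) :
    NE9 (EA F (crossTermFamily F a e) (ContinuousLinearMap.id ℝ ℝ) (Module.Basis.singleton Unit ℝ)) (Window γ) κ
      (fun _ i => wt κ e * (if i = 0 then 2 * |α| * γ else 0)) := by
  refine ne9_EA_cross F (fun g hg g' hg' k => ?_) e κ
  rw [ha, ha]
  simp only [histPrefix_apply, Fin.val_zero]
  have h := marginal_firstEntry_lipschitz (α := α) hc (hg 0).1 (hg 0).2 (hg' 0).1 (hg' 0).2 β₀ k
  refine h.trans (le_of_eq ?_)
  rw [Finset.sum_eq_single_of_mem 0 (Finset.mem_range.mpr (Nat.succ_pos k)) (fun i _ hi => by simp [hi])]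
  simp

end Model

/-! ## §6 ★ THE INSTANCE: one explicit `TermFamily1 F ℝ` carrying §2–§5 (the λ-term amplitude law; nothing defined) -/

/-- ★ **THE MARGINAL-TRANSPORT TERM FAMILY EXISTS IN def-B's INPUT TYPE** (`α ≠ 0`, `0 < c`, `0 < γ`; any `β₀`, `κ`, separation `e`): ONE `TermFamily1 F ℝ` whose def-W1 kernels
are FIRST-ENTRY-ONLY on every window, meet (1.21)-existence and the (5.10) class on `Window γ`, meet N22's NE9 with a bounded first-entry modulus, satisfy the RUN-KEYED step
rate with constant 0 at every rate `θ₅` along `nx b = b∕√(1+cb²)`, and VIOLATE N18's BOX-KEYED `KernelStepRate … γ κ θ₅ C₅` for EVERY `C₅` and EVERY `θ₅ ∈ [0,1[`.  MODEL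
(A6-style located witness for FILE 1 §2–§3); NOT Bałaban's merged term. [cite: Balaban1987RG1, Thm 1 p.259, (1.20)–(1.22) p.264, (5.10) p.293; model] -/
theorem exists_termFamily_firstEntryOnly_boxFails_runExact (F : T4Family) (β₀ : ℝ) {α c γ : ℝ} (hα : α ≠ 0) (hc : 0 < c) (hγ : 0 < γ)
    (e : Fin 4 → ℤ) (κ : ℝ) :
    ∃ ℰ : TermFamily1 F ℝ,
      (∀ g ∈ Window γ, ∀ g' ∈ Window γ, g 0 = g' 0 → ∀ (k : ℕ) (μ ν : Fin 4) (z : Fin 4 → ℤ),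
          kernelA F ℰ (ContinuousLinearMap.id ℝ ℝ) (Module.Basis.singleton Unit ℝ) g k μ ν z =
            kernelA F ℰ (ContinuousLinearMap.id ℝ ℝ) (Module.Basis.singleton Unit ℝ) g' k μ ν z) ∧
      PolLimitsExist F ℰ (ContinuousLinearMap.id ℝ ℝ) (Module.Basis.singleton Unit ℝ) (Window γ) ∧
      (∀ μ ν, KernelDecay F ℰ (ContinuousLinearMap.id ℝ ℝ) (Module.Basis.singleton Unit ℝ) (Window γ) μ ν κ) ∧
      NE9 (EA F ℰ (ContinuousLinearMap.id ℝ ℝ) (Module.Basis.singleton Unit ℝ)) (Window γ) κ (fun _ i => wt κ e * (if i = 0 then 2 * |α| * γ else 0)) ∧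
      (∀ θ₅ : ℝ, ∀ b : ℝ, 0 < b → b ≤ γ → ∀ g ∈ Window γ, g 0 = b / Real.sqrt (1 + c * b ^ 2) → ∀ (k : ℕ) (μ ν : Fin 4) (z : Fin 4 → ℤ),
          |kernelA F ℰ (ContinuousLinearMap.id ℝ ℝ) (Module.Basis.singleton Unit ℝ) g k μ ν z -
              kernelA F ℰ (ContinuousLinearMap.id ℝ ℝ) (Module.Basis.singleton Unit ℝ) (prependCoupling b g) (k + 1) μ ν z| ≤
            0 * θ₅ ^ (k + 1) * Real.exp (-(κ * l1 z))) ∧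
      ∀ (C₅ θ₅ : ℝ), 0 ≤ θ₅ → θ₅ < 1 → ¬ KernelStepRate F ℰ (ContinuousLinearMap.id ℝ ℝ) (Module.Basis.singleton Unit ℝ) γ κ θ₅ C₅ := by
  have ha : ∀ (k : ℕ) (v : Fin (k + 1) → ℝ),
      (fun (k : ℕ) (v : Fin (k + 1) → ℝ) => β₀ + α * (v 0) ^ 2 / (1 + c * k * (v 0) ^ 2)) k v = β₀ + α * (v 0) ^ 2 / (1 + c * k * (v 0) ^ 2) :=
    fun _ _ => rfl
  exact ⟨crossTermFamily F (fun (k : ℕ) (v : Fin (k + 1) → ℝ) => β₀ + α * (v 0) ^ 2 / (1 + c * k * (v 0) ^ 2)) e,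
    kernelA_firstEntryOnly_marginalTransport F ha e γ, polLimitsExist_cross F _ e γ, fun μ ν => kernelDecay_marginalTransport F ha hc.le e γ μ ν κ,
    ne9_EA_marginalTransport F ha hc.le e κ, fun θ₅ => runStepRate_marginalTransport_zero F ha hc.le e γ κ θ₅,
    fun C₅ θ₅ hθ0 hθ1 => not_kernelStepRate_marginalTransport F ha hα hc hγ e κ C₅ hθ0 hθ1⟩

end YMDAG.N18.KernelLettersFirstEntryOnly.Model
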